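import Summits.Ventures.Crystal3D.Theorems.StickyWulffConstantTextureLiminfTentBarlowCount
import Literature.Analysis.Convexity.AnisotropicPerimeterComplement
import HarnessLib

/-!
# TB-D assembly, part 13: LOCALITY OF THE LOCALIZED PERIMETER IN THE SET — `perKIn K A U` only sees `A ∩ U`
# (lane T, crux `TextureLiminfV5`, stmt-Ventures-23912; blueprint HOME/wulff-p2/g20/TB-D-2-g20.md §2 lemma (L-T))

HONEST FRAMING. Venture `Summits/Ventures/Crystal3D` (cell `crystal3d-full`), route `route-Ventures-StickyWulffConstant`, helper `--supports` the
law-v5 crux `TextureLiminfV5` (stmt-Ventures-23912).  One measure-theoretic lemma + its restatements (census-free, standard axioms); F-C1 not moved.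

WHY.  The FREE half of the ledger splitting (`free_le_split`, p715179) pays the exposed tent facets of slab grain `(f,i)` with
`perKIn (W_{f,i}) (⋃ pieces) (U_f ∩ laySlab_i)`, while the certificate (`TentCert.hper`, part 12) bounds `perKIn (W_{f,i}) G_f (U_f ∩ laySlab_i)`.  The two
agree because inside the open set `U_f ∩ laySlab_i` the texture IS the tent solid `G_f` up to a null set (the arrangement planes), and the localized
perimeter only integrates divergences of fields supported INSIDE `U`:
* `setIntegral_fieldDivergence_eq_inter` — for a field with `tsupport φ ⊆ U` (measurable `U`), `∫_A div φ = ∫_{A ∩ U} div φ`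
  (`fieldDivergence_eq_zero_of_notMem_tsupport`, lit …AnisotropicPerimeterComplement);
* **`perKIn_congr_ae_inter`** — `A ∩ U =ᵐ B ∩ U` ⇒ `perKIn K A U = perKIn K B U`;
* `perKIn_congr_inter_eq`, `perKIn_congr_of_open` — the exact-equality and the open-`U` forms.
-/

noncomputable section

namespace Summit.Ventures.Crystal3D.Cruxes.TextureLiminf.TexShadow

open Summit.Ventures.Crystal3D MeasureTheory Set
open scoped ENNReal
open Literature.MathematicalPhysics.StatisticalMechanics (fieldDivergence)
open Literature.Analysis.Convexity (fieldDivergence_eq_zero_of_notMem_tsupport)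

/-- For a field supported inside the measurable set `U`, the divergence integral over `A` is the one over `A ∩ U`. -/
theorem setIntegral_fieldDivergence_eq_inter {φ : E3 → E3} {U : Set E3} (hUm : MeasurableSet U) (hφU : tsupport φ ⊆ U) (A : Set E3) :
    ∫ x in A, fieldDivergence φ x = ∫ x in A ∩ U, fieldDivergence φ x := by
  have hf : (fun x => fieldDivergence φ x) = U.indicator (fun x => fieldDivergence φ x) := by
    funext x
    by_cases hx : x ∈ U
    · rw [indicator_of_mem hx]
    · rw [indicator_of_notMem hx, fieldDivergence_eq_zero_of_notMem_tsupport (fun h => hx (hφU h))]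
  calc ∫ x in A, fieldDivergence φ x = ∫ x in A, U.indicator (fun x => fieldDivergence φ x) x := by rw [← hf]
    _ = ∫ x in A ∩ U, fieldDivergence φ x := setIntegral_indicator hUm

/-- **`perKIn K A U` depends only on the Lebesgue class of `A ∩ U`** (`U` measurable, e.g. open). -/
theorem perKIn_congr_ae_inter {K A B U : Set E3} (hUm : MeasurableSet U) (h : (A ∩ U : Set E3) =ᵐ[volume] (B ∩ U : Set E3)) :
    perKIn K A U = perKIn K B U := by
  unfold perKIn
  have key : ∀ φ : E3 → E3, tsupport φ ⊆ U → ∫ x in A, fieldDivergence φ x = ∫ x in B, fieldDivergence φ x := by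
    intro φ hφU
    rw [setIntegral_fieldDivergence_eq_inter hUm hφU A, setIntegral_fieldDivergence_eq_inter hUm hφU B, setIntegral_congr_set h]
  refine le_antisymm (iSup₂_le fun φ hφ => ?_) (iSup₂_le fun φ hφ => ?_)
  · rw [key φ hφ.2.2.2]
    exact le_iSup₂ (f := fun (φ : E3 → E3) (_ : ContDiff ℝ 1 φ ∧ HasCompactSupport φ ∧ (∀ z, φ z ∈ K) ∧ tsupport φ ⊆ U) =>
      ENNReal.ofReal (∫ z in B, fieldDivergence φ z)) φ hφ
  · rw [← key φ hφ.2.2.2]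
    exact le_iSup₂ (f := fun (φ : E3 → E3) (_ : ContDiff ℝ 1 φ ∧ HasCompactSupport φ ∧ (∀ z, φ z ∈ K) ∧ tsupport φ ⊆ U) =>
      ENNReal.ofReal (∫ z in A, fieldDivergence φ z)) φ hφ

/-- The exact form: `A ∩ U = B ∩ U` ⇒ `perKIn K A U = perKIn K B U`. -/
theorem perKIn_congr_inter_eq {K A B U : Set E3} (hUm : MeasurableSet U) (h : A ∩ U = B ∩ U) : perKIn K A U = perKIn K B U :=
  perKIn_congr_ae_inter hUm (h ▸ ae_eq_refl _)

/-- For an OPEN `U`: the form used by the texture (pieces vs. tent solid a.e. inside `U`). -/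
theorem perKIn_congr_of_open {K A B U : Set E3} (hU : IsOpen U) (h : (A ∩ U : Set E3) =ᵐ[volume] (B ∩ U : Set E3)) :
    perKIn K A U = perKIn K B U :=
  perKIn_congr_ae_inter hU.measurableSet h

end Summit.Ventures.Crystal3D.Cruxes.TextureLiminf.TexShadow

end
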